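import Literature.Computability.AlgebraicComplexity.BD17GaleRootCount
import Mathlib.Topology.Algebra.Order.Field
import HarnessLib

/-!
# Bihan–Dickenstein 2017, Proposition 2.12 (parity) — PROVED (`BD2017_prop_2_12_holds`)

F. Bihan, A. Dickenstein, *Descartes' rule of signs for polynomial systems supported on circuits*,
Int. Math. Res. Not. IMRN 2017 (22) 6867–6893 = arXiv:1601.05826 [BihanDickenstein2017], Prop. 2.12
(p0008:L13) and its proof (§4.2, p0012:L24–40). This file DISCHARGES the named fact
`BD2017_prop_2_12` of `BD17DescartesCircuits.lean` (cell `val-lit`, row X4-BD17). THEOREMS ONLY —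
no new named facts.

The proof FOLLOWS THE PRINTED PROOF with one simplifying choice: the normalized Gale dual of the
proof of Thm. 2.9 (`BD17.IsNormalizedGaleBasis`, p0011:L22–33: `P_{ᾱ_q} = (1,0)`, `P_{ᾱ_j} = (0,1)`)
is taken at the pair `(ᾱ_0, ᾱ_{k−1})` (the print allows any pair). Then, as printed (p0012:L26–35):
"the cone `𝒞_P` equals `ℝ_{>0}P_{ᾱ_0} + ℝ_{>0}P_{ᾱ_{k−1}}`" — here: the ordering forces `ε = 1` and puts
every `P_ℓ` in the closed first quadrant (`BD17.quadrant_of_normalized_ends`), so that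
"`Δ_P = (0, ∞)`" (`BD17.galeInterval_eq_Ioi`), "the endpoints `a` and `b` of `Δ_P` are the roots of
`p_{ᾱ_0}` and `p_{ᾱ_{k−1}}` (where `∞` is considered as the root of the constant `1`)"; "We get that
`n_𝒜(C)` is even or odd according to whether the signs of `g − 1` for `y ∈ Δ_P` close to `a` and `b`
respectively are the same or are different" (`BD17.even_card_roots_Ioo_iff`, the parity of the
number of roots of a real polynomial in an interval counted with multiplicity, applied to the
cleared polynomial of `g − 1`); "the signs of `g − 1` near `a, b` are minus those of `λ̄_{k−1}` and
`λ̄_0`" (`BD17.eventually_galeFun_lt_one` / `…_gt_one`: `g(y) ~ c·y^{λ̄_{k−1}}` at `0⁺`, and at `+∞`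
through the symmetry `g_B(y) = g_{B'}(1/y)` of the column swap, `∑ λ_ℓ = 0`), "so that `n_𝒜(C)` and
`sgnvar(λ̄_0, λ̄_{k−1})` are congruent modulo `2`. It remains to note that `sgnvar(λ̄_0, λ̄_{k−1})` and
the sign variation of the whole sequence `sgnvar(s_α)` are congruent modulo `2`"
(`BD17.even_signVar_ofFn_iff`). Honest framing: a statement about real fewnomial systems on
circuits; nothing here bears on VP vs VNP.
-/

open Matrix Finset Polynomial Filter Topology

namespace Literature.Computability.AlgebraicComplexity

open Literature.Algebra.Polynomial

namespace BD17

open Literature.Algebra.Polynomial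

/-! ### Parity of the sign variation: `sgnvar(c_0, …, c_{k−1}) ≡ sgnvar(c_0, c_{k−1}) (mod 2)` -/

section SignVarParity

/-- Zero-free core: `sgnvar(a, m…, b)` is even iff `a b > 0`. [cite: BihanDickenstein2017, §4.2 (proof of Prop. 2.12)] -/
private theorem even_signVarAux_cons_append_iff (b : ℝ) (hb : b ≠ 0) :
    ∀ (a : ℝ) (m : List ℝ), a ≠ 0 → (∀ x ∈ m, x ≠ 0) →
      (Even (signVarAux (a :: (m ++ [b]))) ↔ 0 < a * b)
  | a, [], ha, _ => by
      show Even ((if a * b < 0 then 1 else 0) + signVarAux [b]) ↔ 0 < a * b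
      have h0 : signVarAux [b] = 0 := rfl
      rw [h0, add_zero]
      by_cases hab : a * b < 0
      · rw [if_pos hab]
        exact ⟨fun h => (Nat.not_even_one h).elim, fun h => (lt_asymm hab h).elim⟩
      · rw [if_neg hab]
        exact ⟨fun _ => (lt_or_gt_of_ne (mul_ne_zero ha hb)).resolve_left hab, fun _ => Even.zero⟩
  | a, c :: m, ha, hm => by
      have hc : c ≠ 0 := hm c (by simp)
      have ih := even_signVarAux_cons_append_iff b hb c m hc (fun x hx => hm x (List.mem_cons_of_mem c hx))
      show Even ((if a * c < 0 then 1 else 0) + signVarAux (c :: (m ++ [b]))) ↔ 0 < a * b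
      have key : (a * b) * (c * b) = (a * c) * (b * b) := by ring
      have hbb : 0 < b * b := mul_self_pos.mpr hb
      by_cases hac : a * c < 0
      · rw [if_pos hac, add_comm, Nat.even_add_one, ih]
        have hneg : (a * b) * (c * b) < 0 := by
          rw [key]
          exact mul_neg_of_neg_of_pos hac hbb
        constructor
        · intro h1
          by_contra h2
          nlinarith [mul_nonneg (neg_nonneg.mpr (not_lt.mp h2)) (neg_nonneg.mpr (not_lt.mp h1))]
        · intro h1 h2
          exact (lt_asymm (mul_pos h1 h2) hneg).elim
      · rw [if_neg hac, zero_add, ih]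
        have hpos : 0 < (a * b) * (c * b) := by
          rw [key]
          exact mul_pos ((lt_or_gt_of_ne (mul_ne_zero ha hc)).resolve_left hac) hbb
        constructor
        · intro h1
          by_contra h2
          nlinarith [mul_nonneg (neg_nonneg.mpr (not_lt.mp h2)) h1.le]
        · intro h1
          by_contra h2
          nlinarith [mul_nonneg h1.le (neg_nonneg.mpr (not_lt.mp h2))]

/-- `sgnvar(a, l…, b)` is even iff `a b > 0` (`a, b ≠ 0`; zeros inside are dropped).
[cite: BihanDickenstein2017, §4.2 (proof of Prop. 2.12)] -/
theorem even_signVar_cons_append_singleton_iff {a b : ℝ} (ha : a ≠ 0) (hb : b ≠ 0) (l : List ℝ) :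
    Even (signVar (a :: (l ++ [b]))) ↔ 0 < a * b := by
  unfold signVar
  rw [List.filter_cons_of_pos (by simpa using ha), List.filter_append,
    show [b].filter (fun x => decide (x ≠ 0)) = [b] by simp [hb]]
  exact even_signVarAux_cons_append_iff b hb a _ ha (fun x hx => by simpa using (List.mem_filter.mp hx).2)

/-- **"`sgnvar(λ̄_0, λ̄_{k−1})` and the sign variation of the whole sequence `sgnvar(s_α)` are congruent
modulo `2`"** (p0012:L39–40), for nonzero end terms: `sgnvar(c_0, …, c_{k−1})` is even iff
`c_0 c_{k−1} > 0`. [cite: BihanDickenstein2017, §4.2 (proof of Prop. 2.12)] -/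
theorem even_signVar_ofFn_iff {k : ℕ} (hk : 2 ≤ k) (f : Fin k → ℝ) (h0 : f ⟨0, by omega⟩ ≠ 0)
    (hl : f ⟨k - 1, by omega⟩ ≠ 0) :
    Even (signVar (List.ofFn f)) ↔ 0 < f ⟨0, by omega⟩ * f ⟨k - 1, by omega⟩ := by
  obtain ⟨t, rfl⟩ : ∃ t, k = t + 2 := ⟨k - 2, by omega⟩
  have e0 : (⟨0, by omega⟩ : Fin (t + 2)) = 0 := rfl
  have el : (⟨t + 2 - 1, by omega⟩ : Fin (t + 2)) = (Fin.last t).succ := by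
    ext
    simp
  rw [el] at hl
  rw [e0, el]
  rw [List.ofFn_succ, List.ofFn_succ', List.concat_eq_append]
  exact even_signVar_cons_append_singleton_iff h0 hl _

end SignVarParity

/-! ### Parity of the number of roots of a real polynomial in an interval, with multiplicity -/

section RootParity

/-- The sign of `∏_{a ∈ M} (s − a)(t − a)` is `(−1)^{#(M ∩ (s,t))}` (no element of `M` equals `s` or `t`).
[cite: BihanDickenstein2017, §4.2 (proof of Prop. 2.12)] -/
private theorem prod_sub_mul_sub_sign (s t : ℝ) (hst : s < t) (M : Multiset ℝ)
    (hM : ∀ a ∈ M, a ≠ s ∧ a ≠ t) :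
    0 < (M.map fun a => (s - a) * (t - a)).prod *
      (-1) ^ Multiset.card (M.filter fun a => s < a ∧ a < t) := by
  induction M using Multiset.induction_on with
  | empty => simp
  | cons a M ih =>
    have ⟨has, hat⟩ := hM a (Multiset.mem_cons_self a M)
    have ih' := ih (fun x hx => hM x (Multiset.mem_cons_of_mem hx))
    rw [Multiset.map_cons, Multiset.prod_cons]
    by_cases hin : s < a ∧ a < t
    · rw [Multiset.filter_cons_of_pos (p := fun a => s < a ∧ a < t) M hin, Multiset.card_cons, pow_succ]
      have hneg : (s - a) * (t - a) < 0 := mul_neg_of_neg_of_pos (by linarith) (by linarith)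
      have : (s - a) * (t - a) * (M.map fun a => (s - a) * (t - a)).prod *
          ((-1) ^ Multiset.card (M.filter fun a => s < a ∧ a < t) * (-1)) =
          (-((s - a) * (t - a))) * ((M.map fun a => (s - a) * (t - a)).prod *
            (-1) ^ Multiset.card (M.filter fun a => s < a ∧ a < t)) := by ring
      rw [this]
      exact mul_pos (neg_pos.mpr hneg) ih'
    · rw [Multiset.filter_cons_of_neg (p := fun a => s < a ∧ a < t) M hin, mul_assoc]
      have hpos : 0 < (s - a) * (t - a) := by
        rcases (lt_or_gt_of_ne has) with h | h
        · exact mul_pos (by linarith) (by linarith)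
        · have hta : t < a := by
            rcases (lt_or_gt_of_ne hat) with h' | h'
            · exact absurd ⟨h, h'⟩ hin
            · exact h'
          exact mul_pos_of_neg_of_neg (by linarith) (by linarith)
      exact mul_pos hpos ih'

/-- A real polynomial without real roots has constant sign: `q(s) q(t) > 0`.
[cite: BihanDickenstein2017, §4.2 (proof of Prop. 2.12)] -/
private theorem mul_pos_of_roots_eq_zero {q : ℝ[X]} (hq : q ≠ 0) (hr : q.roots = 0) (s t : ℝ)
    (hst : s ≤ t) : 0 < q.eval s * q.eval t := by
  have hne : ∀ x, q.eval x ≠ 0 := fun x hx => by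
    have : x ∈ q.roots := (Polynomial.mem_roots hq).mpr hx
    rw [hr] at this
    simp at this
  by_contra h
  push Not at h
  rcases (lt_or_gt_of_ne (hne s)) with hs | hs
  · have ht : 0 ≤ q.eval t := by
      by_contra ht
      push Not at ht
      exact absurd (mul_pos_of_neg_of_neg hs ht) (not_lt.mpr h)
    obtain ⟨c, _, hc⟩ := intermediate_value_Icc hst q.continuous.continuousOn ⟨hs.le, ht⟩
    exact hne c hc
  · have ht : q.eval t ≤ 0 := by
      by_contra ht
      push Not at ht
      exact absurd (mul_pos hs ht) (not_lt.mpr h)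
    obtain ⟨c, _, hc⟩ := intermediate_value_Icc' hst q.continuous.continuousOn ⟨ht, hs.le⟩
    exact hne c hc

/-- **The number of roots of a real polynomial in `(s, t)` counted with multiplicity is even iff
`P(s) P(t) > 0`** (`P(s), P(t) ≠ 0`) — "`n_𝒜(C)` is even or odd according to whether the signs of
`g − 1` … close to `a` and `b` respectively are the same or are different" (p0012:L33–35), for the
cleared polynomial of `g − 1`. [cite: BihanDickenstein2017, §4.2 (proof of Prop. 2.12)] -/
theorem even_card_roots_Ioo_iff {P : ℝ[X]} (hP : P ≠ 0) {s t : ℝ} (hst : s < t)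
    (hs : P.eval s ≠ 0) (ht : P.eval t ≠ 0) :
    Even (Multiset.card (P.roots.filter fun a => s < a ∧ a < t)) ↔ 0 < P.eval s * P.eval t := by
  obtain ⟨q, hq, -, hq0⟩ := P.exists_prod_multiset_X_sub_C_mul
  have hqne : q ≠ 0 := by
    rintro rfl
    rw [mul_zero] at hq
    exact hP hq.symm
  have hev : ∀ x, P.eval x = (P.roots.map fun a => x - a).prod * q.eval x := by
    intro x
    conv_lhs => rw [← hq]
    rw [Polynomial.eval_mul, Polynomial.eval_multiset_prod, Multiset.map_map]
    congr 2
    exact Multiset.map_congr rfl fun a _ => by simp [Function.comp_apply]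
  have hroots : ∀ a ∈ P.roots, a ≠ s ∧ a ≠ t := by
    intro a ha
    have h0 := (Polynomial.mem_roots hP).mp ha
    exact ⟨fun h => hs (h ▸ h0), fun h => ht (h ▸ h0)⟩
  have hsign := prod_sub_mul_sub_sign s t hst P.roots hroots
  have hq2 := mul_pos_of_roots_eq_zero hqne hq0 s t hst.le
  have hprod : P.eval s * P.eval t =
      (P.roots.map fun a => (s - a) * (t - a)).prod * (q.eval s * q.eval t) := by
    rw [hev s, hev t, Multiset.prod_map_mul]
    ring
  rw [hprod]
  rcases Nat.even_or_odd (Multiset.card (P.roots.filter fun a => s < a ∧ a < t)) with he | ho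
  · rw [he.neg_one_pow, mul_one] at hsign
    exact ⟨fun _ => mul_pos hsign hq2, fun _ => he⟩
  · rw [ho.neg_one_pow, mul_neg_one] at hsign
    constructor
    · intro he'
      exact absurd he' (Nat.not_even_iff_odd.mpr ho)
    · intro hpos
      exact (lt_asymm (mul_neg_of_neg_of_pos (neg_pos.mp hsign) hq2) hpos).elim

/-- The root count with multiplicity of a nonzero polynomial on a set `Δ` (Def. 4.1, analytic order
= root multiplicity) is the number of its roots in `Δ` counted with multiplicity.
[cite: BihanDickenstein2017, Def. 4.1] -/
theorem rootCountMult_eval_eq_card_filter {P : ℝ[X]} (hP : P ≠ 0) (Δ : Set ℝ)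
    [DecidablePred (· ∈ Δ)] :
    rootCountMult (fun y => P.eval y) Δ = Multiset.card (P.roots.filter (· ∈ Δ)) := by
  classical
  unfold rootCountMult
  have hset : {y | y ∈ Δ ∧ P.eval y = 0} = ↑(P.roots.toFinset.filter (· ∈ Δ)) := by
    ext y
    simp only [Set.mem_setOf_eq, Finset.coe_filter, Multiset.mem_toFinset, Polynomial.mem_roots hP,
      Polynomial.IsRoot.def]
    tauto
  rw [hset, finsum_mem_coe_finset]
  calc ∑ y ∈ P.roots.toFinset.filter (· ∈ Δ), analyticOrderNatAt (fun y => P.eval y) y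
      = ∑ y ∈ P.roots.toFinset.filter (· ∈ Δ), (P.roots.filter (· ∈ Δ)).count y := by
        refine Finset.sum_congr rfl fun y hy => ?_
        rw [analyticOrderNatAt_eval_realPoly hP, Multiset.count_filter,
          if_pos (Finset.mem_filter.mp hy).2, Polynomial.count_roots]
    _ = ∑ y ∈ (P.roots.filter (· ∈ Δ)).toFinset, (P.roots.filter (· ∈ Δ)).count y := by
        rw [Multiset.toFinset_filter]
    _ = Multiset.card (P.roots.filter (· ∈ Δ)) := Multiset.toFinset_sum_count_eq _

end RootParity

/-! ### Behaviour of `g = ∏ p_ℓ^{μ_ℓ}` at the ends of `(0, ∞)` for a first-quadrant configuration -/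

section Asymptotics

variable {n : ℕ}

/-- `∏_{s} y^{f_i} = y^{∑_s f_i}` (`y ≠ 0`). [folklore] -/
private theorem prod_zpow_eq_zpow_sum {y : ℝ} (hy : y ≠ 0) {ι : Type*} (s : Finset ι) (f : ι → ℤ) :
    ∏ i ∈ s, y ^ f i = y ^ ∑ i ∈ s, f i := by
  classical
  induction s using Finset.induction_on with
  | empty => simp
  | insert a s ha ih => rw [Finset.prod_insert ha, Finset.sum_insert ha, ih, zpow_add₀ hy]

/-- **`g(y) = y^{m} · H(y)` on `(0, ∞)`**, `m = ∑_{B_{ℓ,0}=0} μ_ℓ`, with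
`H(y) = ∏_{B_{ℓ,0}=0} B_{ℓ,1}^{μ_ℓ} · ∏_{B_{ℓ,0}≠0} p_ℓ(y)^{μ_ℓ}` (the rows with `B_{ℓ,0} = 0` are the
`P_ℓ` proportional to `(0,1)`, i.e. `p_ℓ = B_{ℓ,1} y`). [cite: BihanDickenstein2017, §4.2 (proof of Prop. 2.12)] -/
theorem galeFun_eq_zpow_mul (B : Matrix (Fin (n + 2)) (Fin 2) ℝ) (μ : Fin (n + 2) → ℤ) {y : ℝ}
    (hy : 0 < y) :
    galeFun B μ y = y ^ (∑ ℓ ∈ Finset.univ.filter (fun ℓ => B ℓ 0 = 0), μ ℓ) *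
      ((∏ ℓ ∈ Finset.univ.filter (fun ℓ => B ℓ 0 = 0), B ℓ 1 ^ μ ℓ) *
        ∏ ℓ ∈ Finset.univ.filter (fun ℓ => ¬ B ℓ 0 = 0), galeLin B ℓ y ^ μ ℓ) := by
  unfold galeFun
  rw [← Finset.prod_filter_mul_prod_filter_not Finset.univ (fun ℓ => B ℓ 0 = 0), ← mul_assoc]
  congr 1
  rw [← prod_zpow_eq_zpow_sum hy.ne', ← Finset.prod_mul_distrib]
  refine Finset.prod_congr rfl fun ℓ hℓ => ?_
  have h0 : B ℓ 0 = 0 := (Finset.mem_filter.mp hℓ).2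
  rw [galeLin, h0, zero_add, mul_zpow, mul_comm]

/-- `H(y) → H(0) = ∏_{B_{ℓ,0}=0} B_{ℓ,1}^{μ_ℓ} · ∏_{B_{ℓ,0}≠0} B_{ℓ,0}^{μ_ℓ}` as `y → 0`.
[cite: BihanDickenstein2017, §4.2 (proof of Prop. 2.12)] -/
theorem tendsto_galeCofactor (B : Matrix (Fin (n + 2)) (Fin 2) ℝ) (μ : Fin (n + 2) → ℤ) :
    Tendsto (fun y : ℝ => (∏ ℓ ∈ Finset.univ.filter (fun ℓ => B ℓ 0 = 0), B ℓ 1 ^ μ ℓ) *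
        ∏ ℓ ∈ Finset.univ.filter (fun ℓ => ¬ B ℓ 0 = 0), galeLin B ℓ y ^ μ ℓ) (𝓝 0)
      (𝓝 ((∏ ℓ ∈ Finset.univ.filter (fun ℓ => B ℓ 0 = 0), B ℓ 1 ^ μ ℓ) *
        ∏ ℓ ∈ Finset.univ.filter (fun ℓ => ¬ B ℓ 0 = 0), B ℓ 0 ^ μ ℓ)) := by
  refine tendsto_const_nhds.mul (tendsto_finsetProd _ fun ℓ hℓ => ?_)
  have hne : B ℓ 0 ≠ 0 := (Finset.mem_filter.mp hℓ).2
  have hlin : Tendsto (fun y : ℝ => galeLin B ℓ y) (𝓝 0) (𝓝 (B ℓ 0)) := by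
    have : Continuous fun y : ℝ => galeLin B ℓ y := by
      simp only [galeLin]
      exact continuous_const.add (continuous_const.mul continuous_id)
    have h := this.tendsto 0
    simp only [galeLin, mul_zero, add_zero] at h
    exact h
  exact hlin.zpow₀ (μ ℓ) (Or.inl hne)

/-- **Near `y = 0⁺`, `g < 1` if `m = ∑_{B_{ℓ,0}=0} μ_ℓ > 0` and `g > 1` if `m < 0`** (first-quadrant
configuration: all `B_{ℓ,0}, B_{ℓ,1} ≥ 0`, rows nonzero) — "the signs of `g − 1` near `a, b` are minus
those of `λ̄_{k−1}` and `λ̄_0`" (p0012:L36–37). [cite: BihanDickenstein2017, §4.2 (proof of Prop. 2.12)] -/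
theorem eventually_nhdsGT_galeFun (B : Matrix (Fin (n + 2)) (Fin 2) ℝ) (μ : Fin (n + 2) → ℤ)
    (hB0 : ∀ ℓ, 0 ≤ B ℓ 0) (hB1 : ∀ ℓ, 0 ≤ B ℓ 1) (hBne : ∀ ℓ, B ℓ 0 = 0 → B ℓ 1 ≠ 0) :
    (0 < ∑ ℓ ∈ Finset.univ.filter (fun ℓ => B ℓ 0 = 0), μ ℓ →
        ∀ᶠ y in 𝓝[>] (0 : ℝ), galeFun B μ y < 1) ∧
      (∑ ℓ ∈ Finset.univ.filter (fun ℓ => B ℓ 0 = 0), μ ℓ < 0 →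
        ∀ᶠ y in 𝓝[>] (0 : ℝ), 1 < galeFun B μ y) := by
  set m := ∑ ℓ ∈ Finset.univ.filter (fun ℓ => B ℓ 0 = 0), μ ℓ with hm
  set H : ℝ → ℝ := fun y => (∏ ℓ ∈ Finset.univ.filter (fun ℓ => B ℓ 0 = 0), B ℓ 1 ^ μ ℓ) *
    ∏ ℓ ∈ Finset.univ.filter (fun ℓ => ¬ B ℓ 0 = 0), galeLin B ℓ y ^ μ ℓ with hH
  set H0 : ℝ := (∏ ℓ ∈ Finset.univ.filter (fun ℓ => B ℓ 0 = 0), B ℓ 1 ^ μ ℓ) *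
    ∏ ℓ ∈ Finset.univ.filter (fun ℓ => ¬ B ℓ 0 = 0), B ℓ 0 ^ μ ℓ with hH0
  have hHt : Tendsto H (𝓝[>] (0 : ℝ)) (𝓝 H0) :=
    tendsto_nhdsWithin_of_tendsto_nhds (tendsto_galeCofactor B μ)
  have hH0pos : 0 < H0 := by
    refine mul_pos (Finset.prod_pos fun ℓ hℓ => zpow_pos ?_ _)
      (Finset.prod_pos fun ℓ hℓ => zpow_pos ?_ _)
    · exact lt_of_le_of_ne (hB1 ℓ) (Ne.symm (hBne ℓ (Finset.mem_filter.mp hℓ).2))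
    · exact lt_of_le_of_ne (hB0 ℓ) (Ne.symm (Finset.mem_filter.mp hℓ).2)
  have hEq : (fun y => y ^ m * H y) =ᶠ[𝓝[>] (0 : ℝ)] galeFun B μ :=
    eventually_nhdsWithin_of_forall fun y hy => (galeFun_eq_zpow_mul B μ hy).symm
  constructor
  · intro hpos
    have hz : Tendsto (fun y : ℝ => y ^ m) (𝓝[>] (0 : ℝ)) (𝓝 0) := by
      have h := (continuousAt_zpow₀ (0 : ℝ) m (Or.inr hpos.le)).tendsto
      rw [_root_.zero_zpow m hpos.ne'] at h
      exact tendsto_nhdsWithin_of_tendsto_nhds h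
    have hg : Tendsto (galeFun B μ) (𝓝[>] (0 : ℝ)) (𝓝 0) := by
      have := hz.mul hHt
      rw [zero_mul] at this
      exact this.congr' hEq
    exact hg.eventually_lt_const zero_lt_one
  · intro hneg
    have hN : 0 < (-m).toNat := by omega
    have hz : Tendsto (fun y : ℝ => y ^ m) (𝓝[>] (0 : ℝ)) atTop := by
      have h1 : Tendsto (fun y : ℝ => (y⁻¹) ^ (-m).toNat) (𝓝[>] (0 : ℝ)) atTop :=
        (tendsto_pow_atTop hN.ne').comp tendsto_inv_nhdsGT_zero
      refine h1.congr' (eventually_nhdsWithin_of_forall fun y hy => ?_)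
      rw [inv_pow, ← zpow_natCast, Int.toNat_of_nonneg (by omega), _root_.zpow_neg, inv_inv]
    have hg : Tendsto (galeFun B μ) (𝓝[>] (0 : ℝ)) atTop :=
      (hz.atTop_mul_pos hH0pos hHt).congr' hEq
    exact hg.eventually (eventually_gt_atTop 1)

/-- The column swap `P_ℓ = (B_{ℓ,0}, B_{ℓ,1}) ↦ (B_{ℓ,1}, B_{ℓ,0})` (exchanging the roles of the two
ends of `Δ_P`). [cite: BihanDickenstein2017, §4.2 (proof of Prop. 2.12)] -/
def galeSwap (B : Matrix (Fin (n + 2)) (Fin 2) ℝ) : Matrix (Fin (n + 2)) (Fin 2) ℝ :=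
  Matrix.of fun ℓ => ![B ℓ 1, B ℓ 0]

/-- Entries of the swapped matrix. [cite: BihanDickenstein2017, §4.2 (proof of Prop. 2.12)] -/
@[simp] theorem galeSwap_apply_zero (B : Matrix (Fin (n + 2)) (Fin 2) ℝ) (ℓ : Fin (n + 2)) :
    galeSwap B ℓ 0 = B ℓ 1 := by
  simp [galeSwap]

/-- Entries of the swapped matrix. [cite: BihanDickenstein2017, §4.2 (proof of Prop. 2.12)] -/
@[simp] theorem galeSwap_apply_one (B : Matrix (Fin (n + 2)) (Fin 2) ℝ) (ℓ : Fin (n + 2)) :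
    galeSwap B ℓ 1 = B ℓ 0 := by
  simp [galeSwap]

/-- **`g_B(y) = g_{B'}(1/y)`** for the column swap `B'`, `y ≠ 0`, when `∑_ℓ μ_ℓ = 0`
(`p_ℓ(y) = y · (B_{ℓ,1} + B_{ℓ,0}/y)` and `∏ y^{μ_ℓ} = 1`). [cite: BihanDickenstein2017, §4.2 (proof of Prop. 2.12)] -/
theorem galeFun_eq_galeFun_galeSwap_inv (B : Matrix (Fin (n + 2)) (Fin 2) ℝ) (μ : Fin (n + 2) → ℤ)
    (hμ : ∑ ℓ, μ ℓ = 0) {y : ℝ} (hy : y ≠ 0) :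
    galeFun B μ y = galeFun (galeSwap B) μ y⁻¹ := by
  unfold galeFun
  have h : ∀ ℓ, galeLin B ℓ y = y * galeLin (galeSwap B) ℓ y⁻¹ := fun ℓ => by
    simp only [galeLin, galeSwap_apply_zero, galeSwap_apply_one]
    field_simp
    ring
  simp_rw [h, mul_zpow]
  rw [Finset.prod_mul_distrib, prod_zpow_eq_zpow_sum hy, hμ, zpow_zero, one_mul]

/-- **Near `y = +∞`, `g < 1` if `∑_{B_{ℓ,1}=0} μ_ℓ > 0` and `g > 1` if it is `< 0`** (first-quadrant
configuration, `∑ μ_ℓ = 0`; the rows with `B_{ℓ,1} = 0` are the `P_ℓ` proportional to `(1,0)`,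
`g ~ c · y^{−∑_{B_{ℓ,1}=0} μ_ℓ}`). [cite: BihanDickenstein2017, §4.2 (proof of Prop. 2.12)] -/
theorem eventually_atTop_galeFun (B : Matrix (Fin (n + 2)) (Fin 2) ℝ) (μ : Fin (n + 2) → ℤ)
    (hμ : ∑ ℓ, μ ℓ = 0) (hB0 : ∀ ℓ, 0 ≤ B ℓ 0) (hB1 : ∀ ℓ, 0 ≤ B ℓ 1)
    (hBne : ∀ ℓ, B ℓ 1 = 0 → B ℓ 0 ≠ 0) :
    (0 < ∑ ℓ ∈ Finset.univ.filter (fun ℓ => B ℓ 1 = 0), μ ℓ →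
        ∀ᶠ y in atTop, galeFun B μ y < 1) ∧
      (∑ ℓ ∈ Finset.univ.filter (fun ℓ => B ℓ 1 = 0), μ ℓ < 0 →
        ∀ᶠ y in atTop, 1 < galeFun B μ y) := by
  have hsw := eventually_nhdsGT_galeFun (galeSwap B) μ (fun ℓ => by simpa using hB1 ℓ)
    (fun ℓ => by simpa using hB0 ℓ) (fun ℓ h => by simpa using hBne ℓ (by simpa using h))
  simp only [galeSwap_apply_zero] at hsw
  have hpos : ∀ᶠ y : ℝ in atTop, 0 < y := eventually_gt_atTop 0
  constructor
  · intro h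
    filter_upwards [tendsto_inv_atTop_nhdsGT_zero.eventually (hsw.1 h), hpos] with y hy hy0
    rwa [galeFun_eq_galeFun_galeSwap_inv B μ hμ hy0.ne']
  · intro h
    filter_upwards [tendsto_inv_atTop_nhdsGT_zero.eventually (hsw.2 h), hpos] with y hy hy0
    rwa [galeFun_eq_galeFun_galeSwap_inv B μ hμ hy0.ne']

end Asymptotics

/-! ### The normalized basis at the two ends `(ᾱ_0, ᾱ_{k−1})`: a first-quadrant configuration -/

section Ends

variable {n : ℕ} {C : Matrix (Fin n) (Fin (n + 2)) ℝ}

/-- **Proportionality inside a class with a positive factor**: if `ℓ ∈ K_r` and `Δ_P ≠ ∅` then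
`P_ℓ = γ P_{ᾱ_r}` with `γ > 0` ("`P_ℓ = γ_{ℓr} P_{ᾱ_r}`", p0011:L79; positivity from `p_ℓ, p_{ᾱ_r} > 0`
on `Δ_P`). [cite: BihanDickenstein2017, §4.2 (proof of Thm. 2.9)] -/
theorem exists_pos_smul_of_mem_minorClass (hrk : C.rank = n) {K : Finset (Fin (n + 2))}
    (α : Equiv.Perm (Fin (n + 2))) {B : Matrix (Fin (n + 2)) (Fin 2) ℝ} (hBd : IsGaleDual C B)
    {y₀ : ℝ} (hy₀ : y₀ ∈ galeInterval B) {r : Fin K.card} {ℓ : Fin (n + 2)}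
    (hℓ : ℓ ∈ minorClass C K α r) :
    ∃ γ : ℝ, 0 < γ ∧ B ℓ 0 = γ * B (restrictOrdering α K r) 0 ∧
      B ℓ 1 = γ * B (restrictOrdering α K r) 1 := by
  have hdet := (mem_minorClass_iff_galeDet_eq_zero C hrk hBd K α r ℓ).mp hℓ
  unfold galeDet at hdet
  have hpr := hy₀ (restrictOrdering α K r)
  have hpl := hy₀ ℓ
  simp only [galeLin] at hpr hpl
  refine ⟨(B ℓ 0 + B ℓ 1 * y₀) / (B (restrictOrdering α K r) 0 + B (restrictOrdering α K r) 1 * y₀),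
    div_pos hpl hpr, ?_, ?_⟩
  · rw [div_mul_eq_mul_div, eq_div_iff hpr.ne']
    linear_combination (-y₀) * hdet
  · rw [div_mul_eq_mul_div, eq_div_iff hpr.ne']
    linear_combination hdet

variable {w : Fin (n + 2) → Fin n → ℤ}

/-- **With `P_{ᾱ_0} = (1,0)` and `P_{ᾱ_{k−1}} = (0,1)`, every `P_ℓ` lies in the closed first quadrant
and is nonzero** ("Given the ordering `α`, the cone `𝒞_P` … equals `ℝ_{>0}P_{ᾱ_0} + ℝ_{>0}P_{ᾱ_{k−1}}`.
As `(1,0), (0,1)` belong to the chosen Gale dual of `C`, the dual cone `𝒞_P^ν` is contained in the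
first quadrant", p0012:L26–31). [cite: BihanDickenstein2017, §4.2 (proof of Prop. 2.12)] -/
theorem quadrant_of_normalized_ends (hrk : C.rank = n) (hcone : PosConeCond C)
    {α : Equiv.Perm (Fin (n + 2))} (hα : IsOrdering C α) {K : Finset (Fin (n + 2))}
    (hK : IsMaxMinorSet C K) (hk : 0 < K.card) {B : Matrix (Fin (n + 2)) (Fin 2) ℝ}
    (hB : IsNormalizedGaleBasis C (restrictOrdering α K ⟨0, hk⟩)
      (restrictOrdering α K ⟨K.card - 1, Nat.sub_lt hk one_pos⟩) B) (ℓ : Fin (n + 2)) :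
    0 ≤ B ℓ 0 ∧ 0 ≤ B ℓ 1 ∧ (B ℓ 0 ≠ 0 ∨ B ℓ 1 ≠ 0) := by
  have hBd := hB.isGaleDual hrk
  obtain ⟨y₀, hy₀⟩ := galeInterval_nonempty hB hrk hcone
  obtain ⟨ε, hε, hord⟩ := hα B hBd
  set i0 : Fin K.card := ⟨0, hk⟩ with hi0
  set iL : Fin K.card := ⟨K.card - 1, Nat.sub_lt hk one_pos⟩ with hiL
  have hτ : StrictMono fun t : Fin K.card =>
      (K.map α.symm.toEmbedding).orderEmbOfFin (Finset.card_map _) t :=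
    fun _ _ h => (OrderEmbedding.strictMono _) h
  -- the representatives `P_{ᾱ_r}` lie in the closed first quadrant
  have hrep : ∀ r : Fin K.card, 0 ≤ B (restrictOrdering α K r) 0 ∧
      0 ≤ B (restrictOrdering α K r) 1 := by
    intro r
    by_cases hk1 : K.card = 1
    · have hr : r = i0 := Fin.ext (by simp [hi0]; omega)
      rw [hr, hB.left_fst, hB.left_snd]
      exact ⟨zero_le_one, le_rfl⟩
    have hlt : i0 < iL := Fin.lt_def.mpr (by simp [hi0, hiL]; omega)
    have hε1 : ε = 1 := by
      have h := hord _ _ (hτ hlt)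
      change 0 ≤ ε * galeDet B (restrictOrdering α K i0) (restrictOrdering α K iL) at h
      simp only [galeDet, hB.left_fst, hB.left_snd, hB.right_fst, hB.right_snd] at h
      rcases hε with h1 | h1
      · exact h1
      · rw [h1] at h
        norm_num at h
    subst hε1
    constructor
    · rcases (Fin.le_def.mpr (by simp [hiL]; omega) : r ≤ iL).lt_or_eq with h | h
      · have h2 := hord _ _ (hτ h)
        change 0 ≤ 1 * galeDet B (restrictOrdering α K r) (restrictOrdering α K iL) at h2
        simp only [galeDet, hB.right_fst, hB.right_snd] at h2
        linarith
      · rw [h, hB.right_fst]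
    · rcases (Fin.le_def.mpr (by simp [hi0]) : i0 ≤ r).lt_or_eq with h | h
      · have h2 := hord _ _ (hτ h)
        change 0 ≤ 1 * galeDet B (restrictOrdering α K i0) (restrictOrdering α K r) at h2
        simp only [galeDet, hB.left_fst, hB.left_snd] at h2
        linarith
      · rw [← h, hB.left_snd]
  obtain ⟨r, hr⟩ := exists_mem_minorClass C hK α ℓ
  obtain ⟨γ, hγ, h0, h1⟩ := exists_pos_smul_of_mem_minorClass hrk α hBd hy₀ hr
  refine ⟨by rw [h0]; exact mul_nonneg hγ.le (hrep r).1,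
    by rw [h1]; exact mul_nonneg hγ.le (hrep r).2, ?_⟩
  by_contra h
  push Not at h
  have := hy₀ ℓ
  simp only [galeLin, h.1, h.2, zero_mul, add_zero, lt_self_iff_false] at this

/-- **`Δ_P = (0, ∞)`** for the normalized basis at the ends (p0012:L31–33: "the open interval `Δ_P`
is bounded unless `P_{ᾱ_0} = (1,0)` …; the endpoints `a` and `b` of `Δ_P` are the roots of
`p_{ᾱ_0}` and `p_{ᾱ_{k−1}}`", here `a = 0` = the root of `p_{ᾱ_{k−1}} = y`, `b = ∞`).
[cite: BihanDickenstein2017, §4.2 (proof of Prop. 2.12)] -/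
theorem galeInterval_eq_Ioi (hrk : C.rank = n) (hcone : PosConeCond C)
    {α : Equiv.Perm (Fin (n + 2))} (hα : IsOrdering C α) {K : Finset (Fin (n + 2))}
    (hK : IsMaxMinorSet C K) (hk : 0 < K.card) {B : Matrix (Fin (n + 2)) (Fin 2) ℝ}
    (hB : IsNormalizedGaleBasis C (restrictOrdering α K ⟨0, hk⟩)
      (restrictOrdering α K ⟨K.card - 1, Nat.sub_lt hk one_pos⟩) B) :
    galeInterval B = Set.Ioi 0 := by
  ext y
  constructor
  · intro hy
    have := hy (restrictOrdering α K ⟨K.card - 1, Nat.sub_lt hk one_pos⟩)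
    simp only [galeLin, hB.right_fst, hB.right_snd, zero_add, one_mul] at this
    exact this
  · intro hy ℓ
    obtain ⟨h0, h1, hne⟩ := quadrant_of_normalized_ends hrk hcone hα hK hk hB ℓ
    simp only [galeLin]
    rcases hne with h | h
    · exact add_pos_of_pos_of_nonneg (lt_of_le_of_ne h0 (Ne.symm h)) (mul_nonneg h1 hy.le)
    · exact add_pos_of_nonneg_of_pos h0 (mul_pos (lt_of_le_of_ne h1 (Ne.symm h)) hy)

/-- The last class `K_{k−1}` consists of the `ℓ` with `B_{ℓ,0} = 0` (`P_ℓ ∥ (0,1) = P_{ᾱ_{k−1}}`), so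
`λ̄_{k−1} = ∑_{B_{ℓ,0}=0} λ_ℓ`. [cite: BihanDickenstein2017, §4.2 (proof of Prop. 2.12)] -/
theorem lambdaBar_last_eq (hrk : C.rank = n) {α : Equiv.Perm (Fin (n + 2))}
    {K : Finset (Fin (n + 2))} (hk : 0 < K.card) {B : Matrix (Fin (n + 2)) (Fin 2) ℝ}
    (hB : IsNormalizedGaleBasis C (restrictOrdering α K ⟨0, hk⟩)
      (restrictOrdering α K ⟨K.card - 1, Nat.sub_lt hk one_pos⟩) B) :
    lambdaBar w C K α ⟨K.card - 1, Nat.sub_lt hk one_pos⟩ =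
      ∑ ℓ ∈ Finset.univ.filter (fun ℓ => B ℓ 0 = 0), affRel w ℓ := by
  unfold lambdaBar
  congr 1
  ext ℓ
  rw [mem_minorClass_iff_galeDet_eq_zero C hrk (hB.isGaleDual hrk) K α _ ℓ]
  simp [galeDet, hB.right_fst, hB.right_snd]

/-- The first class `K_0` consists of the `ℓ` with `B_{ℓ,1} = 0` (`P_ℓ ∥ (1,0) = P_{ᾱ_0}`), so
`λ̄_0 = ∑_{B_{ℓ,1}=0} λ_ℓ`. [cite: BihanDickenstein2017, §4.2 (proof of Prop. 2.12)] -/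
theorem lambdaBar_first_eq (hrk : C.rank = n) {α : Equiv.Perm (Fin (n + 2))}
    {K : Finset (Fin (n + 2))} (hk : 0 < K.card) {B : Matrix (Fin (n + 2)) (Fin 2) ℝ}
    (hB : IsNormalizedGaleBasis C (restrictOrdering α K ⟨0, hk⟩)
      (restrictOrdering α K ⟨K.card - 1, Nat.sub_lt hk one_pos⟩) B) :
    lambdaBar w C K α ⟨0, hk⟩ = ∑ ℓ ∈ Finset.univ.filter (fun ℓ => B ℓ 1 = 0), affRel w ℓ := by
  unfold lambdaBar
  congr 1
  ext ℓ
  rw [mem_minorClass_iff_galeDet_eq_zero C hrk (hB.isGaleDual hrk) K α _ ℓ]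
  simp [galeDet, hB.left_fst, hB.left_snd]

end Ends

/-! ### Assembly -/

section Assembly

variable {n : ℕ} {w : Fin (n + 2) → Fin n → ℤ} {C : Matrix (Fin n) (Fin (n + 2)) ℝ}

/-- `∑_ℓ λ_ℓ = 0` (2.1). [cite: BihanDickenstein2017, §2.1 eq. (2.1)] -/
theorem sum_affRel_eq_zero (w : Fin (n + 2) → Fin n → ℤ) : ∑ ℓ, affRel w ℓ = 0 := by
  rw [← expMatrix_mulVec_zero w (affRel w), expMatrix_mulVec_affRel w]
  rfl

/-- **The parity of `n_𝒜(C)`** for the normalized basis at the ends: with `s_- = λ̄_{k−1}` and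
`s_+ = λ̄_0` both nonzero, `n_𝒜(C)` is even iff `λ̄_0 λ̄_{k−1} > 0` (p0012:L33–39).
[cite: BihanDickenstein2017, §4.2 (proof of Prop. 2.12)] -/
theorem even_numPosSols_iff (hrk : RankCond w C) (hcone : PosConeCond C) (hcirc : IsCircuit w)
    {α : Equiv.Perm (Fin (n + 2))} (hα : IsOrdering C α) {K : Finset (Fin (n + 2))}
    (hK : IsMaxMinorSet C K) (hfin : (posSolutions w C).Finite) (hk : 0 < K.card)
    (hne : (⟨0, hk⟩ : Fin K.card) ≠ ⟨K.card - 1, Nat.sub_lt hk one_pos⟩)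
    (h0 : lambdaBar w C K α ⟨0, hk⟩ ≠ 0)
    (hL : lambdaBar w C K α ⟨K.card - 1, Nat.sub_lt hk one_pos⟩ ≠ 0) :
    Even (numPosSols w C) ↔
      0 < lambdaBar w C K α ⟨0, hk⟩ * lambdaBar w C K α ⟨K.card - 1, Nat.sub_lt hk one_pos⟩ := by
  classical
  set i0 : Fin K.card := ⟨0, hk⟩ with hi0
  set iL : Fin K.card := ⟨K.card - 1, Nat.sub_lt hk one_pos⟩ with hiL
  have hab : restrictOrdering α K i0 ≠ restrictOrdering α K iL :=
    fun h => hne (restrictOrdering_injective α K h)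
  have hmin : coeffMinor C (restrictOrdering α K i0) (restrictOrdering α K iL) ≠ 0 :=
    hK.1 _ (restrictOrdering_mem α K i0) _ (restrictOrdering_mem α K iL) hab
  obtain ⟨B, hB⟩ := exists_isNormalizedGaleBasis C hrk.2 hab hmin
  have hG := galePoly_ne_zero_of_finite hrk hcirc hab hmin hB hcone hfin
  have hquad := quadrant_of_normalized_ends hrk.2 hcone hα hK hk hB
  have hΔ := galeInterval_eq_Ioi hrk.2 hcone hα hK hk hB
  -- `n_𝒜(C)` = number of roots of the cleared polynomial in `(0, ∞)` counted with multiplicity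
  have hN : numPosSols w C =
      Multiset.card ((galePoly B (affRel w)).roots.filter (· ∈ Set.Ioi (0 : ℝ))) := by
    rw [numPosSols_eq_rootCountMult_eval hrk hcirc hab hmin hB hG, hΔ,
      rootCountMult_eval_eq_card_filter hG]
  -- the signs of `g − 1` near `0⁺` (governed by `λ̄_{k−1}`) and near `+∞` (governed by `λ̄_0`)
  have hB0 : ∀ ℓ, 0 ≤ B ℓ 0 := fun ℓ => (hquad ℓ).1
  have hB1 : ∀ ℓ, 0 ≤ B ℓ 1 := fun ℓ => (hquad ℓ).2.1
  have hev0 := eventually_nhdsGT_galeFun B (affRel w) hB0 hB1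
    (fun ℓ h => ((hquad ℓ).2.2.resolve_left (not_not.mpr h)))
  have hevT := eventually_atTop_galeFun B (affRel w) (sum_affRel_eq_zero w) hB0 hB1
    (fun ℓ h => by
      rcases (hquad ℓ).2.2 with h' | h'
      · exact h'
      · exact absurd h h')
  rw [← lambdaBar_last_eq (w := w) hrk.2 hk hB] at hev0
  rw [← lambdaBar_first_eq (w := w) hrk.2 hk hB] at hevT
  -- sign of `g − 1` as a function of a nonzero integer `λ̄`: `< 1` iff `λ̄ > 0`
  have hsgn0 : ∀ᶠ y in 𝓝[>] (0 : ℝ),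
      (0 < galeFun B (affRel w) y - 1 ↔ lambdaBar w C K α iL < 0) := by
    rcases (lt_or_gt_of_ne hL) with h | h
    · filter_upwards [hev0.2 h] with y hy
      exact ⟨fun _ => h, fun _ => by linarith⟩
    · filter_upwards [hev0.1 h] with y hy
      exact ⟨fun h' => by linarith, fun h' => absurd h (not_lt.mpr h'.le)⟩
  have hsgnT : ∀ᶠ y in atTop,
      (0 < galeFun B (affRel w) y - 1 ↔ lambdaBar w C K α i0 < 0) := by
    rcases (lt_or_gt_of_ne h0) with h | h
    · filter_upwards [hevT.2 h] with y hy
      exact ⟨fun _ => h, fun _ => by linarith⟩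
    · filter_upwards [hevT.1 h] with y hy
      exact ⟨fun h' => by linarith, fun h' => absurd h (not_lt.mpr h'.le)⟩
  -- choose `s` below all positive roots and `t` above all roots, in the asymptotic regimes
  set P := galePoly B (affRel w) with hP
  have hroots0 : ∀ᶠ y in 𝓝[>] (0 : ℝ), ∀ a ∈ P.roots.toFinset, 0 < a → y < a := by
    refine (P.roots.toFinset.eventually_all).mpr fun a _ => ?_
    by_cases ha : 0 < a
    · filter_upwards [Ioo_mem_nhdsGT ha] with y hy
      exact fun _ => hy.2
    · exact Filter.Eventually.of_forall fun y h => absurd h ha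
  obtain ⟨s, ⟨hs0, hsroots⟩, hspos⟩ :=
    ((hsgn0.and hroots0).and self_mem_nhdsWithin).exists
  have hrootsT : ∀ᶠ y in atTop, ∀ a ∈ P.roots.toFinset, a < y :=
    (P.roots.toFinset.eventually_all).mpr fun a _ => eventually_gt_atTop a
  obtain ⟨t, ⟨htT, htroots⟩, hst⟩ := ((hsgnT.and hrootsT).and (eventually_gt_atTop s)).exists
  have hspos' : (0 : ℝ) < s := hspos
  have htpos : (0 : ℝ) < t := hspos'.trans hst
  -- the roots in `(0, ∞)` are the roots in `(s, t)`
  have hfilter : P.roots.filter (· ∈ Set.Ioi (0 : ℝ)) = P.roots.filter fun a => s < a ∧ a < t := by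
    refine Multiset.filter_congr fun a ha => ?_
    have ha' : a ∈ P.roots.toFinset := Multiset.mem_toFinset.mpr ha
    simp only [Set.mem_Ioi]
    exact ⟨fun h => ⟨hsroots a ha' h, htroots a ha'⟩, fun h => hspos'.trans h.1⟩
  have hPs : P.eval s ≠ 0 := fun h => by
    have : s ∈ P.roots.toFinset := Multiset.mem_toFinset.mpr ((Polynomial.mem_roots hG).mpr h)
    exact lt_irrefl s (hsroots s this hspos')
  have hPt : P.eval t ≠ 0 := fun h => by
    have : t ∈ P.roots.toFinset := Multiset.mem_toFinset.mpr ((Polynomial.mem_roots hG).mpr h)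
    exact lt_irrefl t (htroots t this)
  rw [hN, hfilter, even_card_roots_Ioo_iff hG hst hPs hPt]
  -- signs at `s` and `t`: `P = galeDen · (g − 1)` with `galeDen > 0`
  have hs' : s ∈ galeInterval B := by rw [hΔ]; exact hspos'
  have ht' : t ∈ galeInterval B := by rw [hΔ]; exact htpos
  rw [eval_galePoly_eq_galeDen_mul B _ hs', eval_galePoly_eq_galeDen_mul B _ ht']
  have hds := galeDen_pos B (affRel w) hs'
  have hdt := galeDen_pos B (affRel w) ht'
  have key : 0 < galeDen B (affRel w) s * (galeFun B (affRel w) s - 1) *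
      (galeDen B (affRel w) t * (galeFun B (affRel w) t - 1)) ↔
      0 < (galeFun B (affRel w) s - 1) * (galeFun B (affRel w) t - 1) := by
    rw [show galeDen B (affRel w) s * (galeFun B (affRel w) s - 1) *
        (galeDen B (affRel w) t * (galeFun B (affRel w) t - 1)) =
        (galeDen B (affRel w) s * galeDen B (affRel w) t) *
          ((galeFun B (affRel w) s - 1) * (galeFun B (affRel w) t - 1)) by ring]
    exact mul_pos_iff_of_pos_left (mul_pos hds hdt)
  rw [key]
  -- `g(s) − 1`, `g(t) − 1` are nonzero with signs `−sgn λ̄_{k−1}`, `−sgn λ̄_0`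
  have hgs : galeFun B (affRel w) s - 1 ≠ 0 := by
    intro h
    have : P.eval s = 0 := by rw [hP, eval_galePoly_eq_galeDen_mul B _ hs', h, mul_zero]
    exact hPs this
  have hgt : galeFun B (affRel w) t - 1 ≠ 0 := by
    intro h
    have : P.eval t = 0 := by rw [hP, eval_galePoly_eq_galeDen_mul B _ ht', h, mul_zero]
    exact hPt this
  -- four sign cases, through the characterisations `hs0`, `htT`
  constructor
  · intro h
    rcases (lt_or_gt_of_ne hgs) with h1 | h1
    · have h2 : galeFun B (affRel w) t - 1 < 0 := by
        by_contra h2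
        push Not at h2
        nlinarith
      have hLp : 0 < lambdaBar w C K α iL := by
        rcases (lt_or_gt_of_ne hL) with h3 | h3
        · exact absurd (hs0.mpr h3) (not_lt.mpr h1.le)
        · exact h3
      have h0p : 0 < lambdaBar w C K α i0 := by
        rcases (lt_or_gt_of_ne h0) with h3 | h3
        · exact absurd (htT.mpr h3) (not_lt.mpr h2.le)
        · exact h3
      exact mul_pos h0p hLp
    · have h2 : 0 < galeFun B (affRel w) t - 1 := by
        by_contra h2
        push Not at h2
        nlinarith
      exact mul_pos_of_neg_of_neg (htT.mp h2) (hs0.mp h1)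
  · intro h
    rcases (lt_or_gt_of_ne hL) with h3 | h3
    · have h4 : lambdaBar w C K α i0 < 0 := by
        by_contra h4
        push Not at h4
        nlinarith
      exact mul_pos (hs0.mpr h3) (htT.mpr h4)
    · have h4 : 0 < lambdaBar w C K α i0 := by
        by_contra h4
        push Not at h4
        nlinarith
      have h5 : galeFun B (affRel w) s - 1 < 0 :=
        ((lt_or_gt_of_ne hgs)).resolve_right fun h' => absurd (hs0.mp h') (not_lt.mpr h3.le)
      have h6 : galeFun B (affRel w) t - 1 < 0 :=
        ((lt_or_gt_of_ne hgt)).resolve_right fun h' => absurd (htT.mp h') (not_lt.mpr h4.le)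
      exact mul_pos_of_neg_of_neg h5 h6

end Assembly

end BD17

/-! ### The discharge -/

open BD17 in
/-- **BD 2017, Prop. 2.12 — DISCHARGED** (`theorem BD2017_prop_2_12_holds : BD2017_prop_2_12`):
under the hypotheses of Thm. 2.9 with `n_𝒜(C)` finite and `λ̄_0, λ̄_{k−1} ≠ 0`, the difference
`sgnvar(s_α) − n_𝒜(C)` is even; hence `n_𝒜(C) > 0` if `sgnvar(s_α)` is odd.
[cite: BihanDickenstein2017, Prop. 2.12] -/
theorem BD2017_prop_2_12_holds : BD2017_prop_2_12 := by
  intro n w C hrk hcone hcirc α hα K hK hfin hk h0 hL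
  classical
  have hC := span_cols_erase_eq_top C hrk.2 hcone
  -- `k ≥ 2`: for `k = 1`, `λ̄_0 = ∑_ℓ λ_ℓ = 0`
  have hk2 : 2 ≤ K.card := by
    by_contra h
    have hk1 : K.card = 1 := by omega
    have hsum := sum_lambdaBar_eq_zero w C hC hK α
    have : ∑ r : Fin K.card, lambdaBar w C K α r = lambdaBar w C K α ⟨0, hk⟩ := by
      apply Finset.sum_eq_single
      · intro r _ hr
        exact absurd (Fin.ext (by have := r.isLt; simp only; omega)) hr
      · intro h'
        exact absurd (Finset.mem_univ _) h'
    exact h0 (this ▸ hsum)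
  have hne : (⟨0, hk⟩ : Fin K.card) ≠ ⟨K.card - 1, Nat.sub_lt hk one_pos⟩ := by
    intro h
    have := congrArg Fin.val h
    simp only at this
    omega
  have hpar := even_numPosSols_iff hrk hcone hcirc hα hK hfin hk hne h0 hL
  have hsv : Even (signVar (sAlpha w C K α)) ↔
      0 < lambdaBar w C K α ⟨0, hk⟩ * lambdaBar w C K α ⟨K.card - 1, Nat.sub_lt hk one_pos⟩ := by
    unfold sAlpha
    rw [even_signVar_ofFn_iff hk2 (fun j : Fin K.card => (lambdaBar w C K α j : ℝ))
      (by exact_mod_cast h0) (by exact_mod_cast hL)]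
    exact_mod_cast Iff.rfl
  refine ⟨?_, ?_⟩
  · rw [Int.even_sub, Int.even_coe_nat, Int.even_coe_nat]
    exact hsv.trans hpar.symm
  · intro hodd
    have hN : ¬ Even (numPosSols w C) := fun h =>
      (Nat.not_even_iff_odd.mpr hodd) (hsv.mpr (hpar.mp h))
    by_contra hempty
    rw [Set.not_nonempty_iff_eq_empty] at hempty
    apply hN
    simp [numPosSols, hempty]

end Literature.Computability.AlgebraicComplexity
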